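import Mathlib
import HarnessLib
import Summits.HubbardSuperconductivity.HubbardSuperconductivity.Theorems.KLProgrammeKLRegimeThinOverlapIncrementRows

/-!
# K3 VL child `KLRegimeVolumeLimitV17F2` (stmt-HubbardSuperconductivity-20440), located item #23 «W2-HALF-VL», brick «W2H-OVL» part 13 (WEIGHT DOMINATION):
# from the two-scale weight `1 + s₀|z̃₁| + (ρ/x)|z̃₂|₁` of the rate file to the tree weight `w_{k+1}` of the re-analysis rows

Cell `gate-hubbard-kl`, seat p3 (g14), lead of #23.  `charSumWt_thinPairDiff_le_incrScale` (`…ThinPairDiffIncrScale`) bounds the weighted `ℓ¹` of the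
thin-pair frame difference at the rates `(s₀, ρ/x)`; `rowSumWt_klReanalysis_sub_le` (`…ThinOverlapIncrementRows`) wants it at the tree weight of scale `k+1`,
`w_{k+1}(z) = 1 + (Λ_{k+1}β/2M)|z̃₁| + Λ_{k+1}(|z̃₂⁰| + |z̃₂¹|)`.  The comparison is pointwise: `w_{k+1} ≤ D_w·(1 + s₀|z̃₁| + (ρ/x)|z̃₂|₁)` as soon as `1 ≤ D_w`,
`Λ_{k+1}β/(2M) ≤ D_w s₀`, `Λ_{k+1} ≤ D_w·ρ/x` (the (c-D) weight comparison of k3c3-p2's telescope: `D_w ≍ Λ_{k+1}·x/ρ`).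

* `sum_momentWt_le_of_rates` — the generic three-rate comparison of moment-weighted sums;
* **`rowSumWt_klReanalysis_sub_le_of_rates`**, **`colSumWt_klReanalysis_sub_le_of_rates`** — the (R-row/col) pieces of p603893 from a uniform bound `T` at ANY
  rates `(s₀, s₁)` dominating the scale-`(k+1)` weight with constant `D_w`: rows `≤ ε·((27+27)·(3(D_w T)/(βV²)))`, columns `≤ ε·((54+54)·(3(D_w T)/(βV²)))`.

Everything is proved; no definitions, no sorry.  Nothing asserts any stub, K3, VL or superconductivity. [cite: BenfattoGiulianiMastropietro2006, §2.7 (2.71a), §3 (3.3)]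
-/

noncomputable section

namespace Summit.HubbardSuperconductivity.HubbardSuperconductivity.Theorems.TorusFourierL2

set_option linter.dupNamespace false -- summit = problem name (single-conjunct summit), D-0017

open Finset Literature.MathematicalPhysics.QuantumLattice Literature.Probability.LatticeModels
open Summit.HubbardSuperconductivity.HubbardSuperconductivity.Theorems.KLProgrammeLegKernels
open Summit.HubbardSuperconductivity.HubbardSuperconductivity.Theorems.KLRegimeSplit
open Summit.HubbardSuperconductivity.HubbardSuperconductivity.Theorems.EngineV8
open Summit.HubbardSuperconductivity.HubbardSuperconductivity.Theorems.PerturbedFermiCurve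
open Summit.HubbardSuperconductivity.HubbardSuperconductivity.Theorems.TwoVolumeSource
open scoped Real

open Classical

/-- **Three-rate comparison of moment-weighted sums**: if `1 ≤ D`, `a ≤ D a′`, `b ≤ D b′` then
`Σ_z (1 + a|z̃₁| + b|z̃₂⁰| + b|z̃₂¹|)·g(z) ≤ D·Σ_z (1 + a′|z̃₁| + b′|z̃₂⁰| + b′|z̃₂¹|)·g(z)` for every `g ≥ 0`. [folklore] -/
theorem sum_momentWt_le_of_rates {P L : ℕ} [NeZero P] [NeZero L] {a b a' b' D : ℝ} (hD : 1 ≤ D)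
    (hDa : a ≤ D * a') (hDb : b ≤ D * b') (g : TorusSite 1 P × TorusSite 2 L → ℝ) (hg : ∀ z, 0 ≤ g z) :
    ∑ z : TorusSite 1 P × TorusSite 2 L,
        (1 + a * |(((z.1 0).valMinAbs : ℤ) : ℝ)| + b * |(((z.2 0).valMinAbs : ℤ) : ℝ)| + b * |(((z.2 1).valMinAbs : ℤ) : ℝ)|) * g z ≤
      D * ∑ z : TorusSite 1 P × TorusSite 2 L,
        (1 + a' * |(((z.1 0).valMinAbs : ℤ) : ℝ)| + b' * |(((z.2 0).valMinAbs : ℤ) : ℝ)| + b' * |(((z.2 1).valMinAbs : ℤ) : ℝ)|) * g z := by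
  rw [Finset.mul_sum]
  refine Finset.sum_le_sum fun z _ => ?_
  rw [← mul_assoc]
  refine mul_le_mul_of_nonneg_right ?_ (hg z)
  have h0 : 0 ≤ |(((z.1 0).valMinAbs : ℤ) : ℝ)| := abs_nonneg _
  have h1 : 0 ≤ |(((z.2 0).valMinAbs : ℤ) : ℝ)| := abs_nonneg _
  have h2 : 0 ≤ |(((z.2 1).valMinAbs : ℤ) : ℝ)| := abs_nonneg _
  have e : D * (1 + a' * |(((z.1 0).valMinAbs : ℤ) : ℝ)| + b' * |(((z.2 0).valMinAbs : ℤ) : ℝ)| + b' * |(((z.2 1).valMinAbs : ℤ) : ℝ)|) =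
      D + D * a' * |(((z.1 0).valMinAbs : ℤ) : ℝ)| + D * b' * |(((z.2 0).valMinAbs : ℤ) : ℝ)| + D * b' * |(((z.2 1).valMinAbs : ℤ) : ℝ)| := by ring
  rw [e]
  have t1 := mul_le_mul_of_nonneg_right hDa h0
  have t2 := mul_le_mul_of_nonneg_right hDb h1
  have t3 := mul_le_mul_of_nonneg_right hDb h2
  linarith only [hD, t1, t2, t3]

variable {L M : ℕ} [NeZero L] [NeZero M]

/-- **Weighted ROWS of the re-analysis increment from a uniform bound at dominating rates** (see the module docstring).
[cite: BenfattoGiulianiMastropietro2006, §2.7 (2.71)–(2.71a), §3 (3.3)] -/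
theorem rowSumWt_klReanalysis_sub_le_of_rates {β : ℝ} (hβ : 0 < β) (μ : ℝ) (K K' : TrigPolyC4v) (k : ℕ) {T s₀ s₁ Dw : ℝ} (hT0 : 0 ≤ T)
    (hDw : 1 ≤ Dw) (hdom₀ : klScale klE0 (k + 1) * β / (2 * M) ≤ Dw * s₀) (hdom₁ : klScale klE0 (k + 1) ≤ Dw * s₁)
    (hT : ∀ (ω₁ : Fin (sectorCount (k + 1))) (a' : Fin (sectorCount k)), ∑ z : TorusSite 1 (2 * M) × TorusSite 2 L,
      (1 + s₀ * |(((z.1 0).valMinAbs : ℤ) : ℝ)| + s₁ * |(((z.2 0).valMinAbs : ℤ) : ℝ)| + s₁ * |(((z.2 1).valMinAbs : ℤ) : ℝ)|) *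
      ‖∑ q : TorusSite 1 (2 * M) × TorusSite 2 L, (torusChar q.1 z.1 * torusChar q.2 z.2) •
        (klAnisoFamily L M β μ K' klE0 (k + 1) ω₁ (⟨(q.1 0).val, ZMod.val_lt (q.1 0)⟩, q.2) *
            klAnisoFamily L M β μ K' klE0 k a' (⟨(q.1 0).val, ZMod.val_lt (q.1 0)⟩, q.2) -
          klAnisoFamily L M β μ K klE0 (k + 1) ω₁ (⟨(q.1 0).val, ZMod.val_lt (q.1 0)⟩, q.2) *
            klAnisoFamily L M β μ K klE0 k a' (⟨(q.1 0).val, ZMod.val_lt (q.1 0)⟩, q.2))‖ ≤ T)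
    (X'' : SpaceTimeIdx L M × SectorLeg (sectorCount (k + 1))) :
    ∑ X' : SpaceTimeIdx L M × SectorLeg (sectorCount k), ‖(klReanalysis L M β μ K' k - klReanalysis L M β μ K k) X'' X'‖ *
        klScaleWt L M β (k + 1) {latticeLegPos (2 * (2 * M)) X'', latticeLegPos (2 * (2 * M)) X'} ≤
      imagTimeWeight β M * (((27 : ℕ) + (27 : ℕ)) * (3 * (Dw * T) / (β * (L : ℝ) ^ 2))) := by
  have hDw0 : 0 ≤ Dw := zero_le_one.trans hDw
  refine rowSumWt_klReanalysis_sub_le hβ μ K K' k (mul_nonneg hDw0 hT0) (fun ω₁ a' => ?_) X''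
  refine (sum_momentWt_le_of_rates hDw hdom₀ hdom₁ _ (fun z => norm_nonneg _)).trans ?_
  exact mul_le_mul_of_nonneg_left (hT ω₁ a') hDw0

/-- **Weighted COLUMNS of the re-analysis increment from a uniform bound at dominating rates**.
[cite: BenfattoGiulianiMastropietro2006, §2.7 (2.71)–(2.71a), §3 (3.3)] -/
theorem colSumWt_klReanalysis_sub_le_of_rates {β : ℝ} (hβ : 0 < β) (μ : ℝ) (K K' : TrigPolyC4v) (k : ℕ) {T s₀ s₁ Dw : ℝ} (hT0 : 0 ≤ T)
    (hDw : 1 ≤ Dw) (hdom₀ : klScale klE0 (k + 1) * β / (2 * M) ≤ Dw * s₀) (hdom₁ : klScale klE0 (k + 1) ≤ Dw * s₁)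
    (hT : ∀ (ω₁ : Fin (sectorCount (k + 1))) (a' : Fin (sectorCount k)), ∑ z : TorusSite 1 (2 * M) × TorusSite 2 L,
      (1 + s₀ * |(((z.1 0).valMinAbs : ℤ) : ℝ)| + s₁ * |(((z.2 0).valMinAbs : ℤ) : ℝ)| + s₁ * |(((z.2 1).valMinAbs : ℤ) : ℝ)|) *
      ‖∑ q : TorusSite 1 (2 * M) × TorusSite 2 L, (torusChar q.1 z.1 * torusChar q.2 z.2) •
        (klAnisoFamily L M β μ K' klE0 (k + 1) ω₁ (⟨(q.1 0).val, ZMod.val_lt (q.1 0)⟩, q.2) *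
            klAnisoFamily L M β μ K' klE0 k a' (⟨(q.1 0).val, ZMod.val_lt (q.1 0)⟩, q.2) -
          klAnisoFamily L M β μ K klE0 (k + 1) ω₁ (⟨(q.1 0).val, ZMod.val_lt (q.1 0)⟩, q.2) *
            klAnisoFamily L M β μ K klE0 k a' (⟨(q.1 0).val, ZMod.val_lt (q.1 0)⟩, q.2))‖ ≤ T)
    (X' : SpaceTimeIdx L M × SectorLeg (sectorCount k)) :
    ∑ X'' : SpaceTimeIdx L M × SectorLeg (sectorCount (k + 1)), ‖(klReanalysis L M β μ K' k - klReanalysis L M β μ K k) X'' X'‖ *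
        klScaleWt L M β (k + 1) {latticeLegPos (2 * (2 * M)) X'', latticeLegPos (2 * (2 * M)) X'} ≤
      imagTimeWeight β M * (((27 * 2 ^ (k + 1 - k) : ℕ) + (27 * 2 ^ (k + 1 - k) : ℕ)) * (3 * (Dw * T) / (β * (L : ℝ) ^ 2))) := by
  have hDw0 : 0 ≤ Dw := zero_le_one.trans hDw
  refine colSumWt_klReanalysis_sub_le hβ μ K K' k (mul_nonneg hDw0 hT0) (fun ω₁ a' => ?_) X'
  refine (sum_momentWt_le_of_rates hDw hdom₀ hdom₁ _ (fun z => norm_nonneg _)).trans ?_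
  exact mul_le_mul_of_nonneg_left (hT ω₁ a') hDw0

end Summit.HubbardSuperconductivity.HubbardSuperconductivity.Theorems.TorusFourierL2

end
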